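/-
Copyright (c) 2026 the pub-hodgecm-mathlib formalisation cell (harness21).  Seat LA2-p03 (g9), line «L2», DEFAULT task after the LEAD's word
«M-152» ∕ «M-152b» (the crux's cone reduced to ONE printed letter #184♮), 2026-09-03.
★ file F5 (HEAD) of the chain «HLiu418 OF #184♮»: the crux decl `HCCMUnconditional.HLiu418` from the Hodge-free non-orthogonality letter #184♮ and the
route item `H413` ONLY, Theorems-homed and kernel-checked.  No `def`, no `sorry`, axioms TRIO.
-/
import Summits.HodgeConjecture.HodgeConjecture.Theorems.F0P6LD1StubS1FactsOfA2P
import Summits.HodgeConjecture.HodgeConjecture.Theorems.F0P6LD2StubS1bFactsOfA2P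
import Summits.HodgeConjecture.HodgeConjecture.Theorems.F0AlbCmThetaRowsOfFacts
import Summits.HodgeConjecture.HodgeConjecture.Theorems.A3Liu418Thm415AtFaceOfThmD6
import Summits.HodgeConjecture.HodgeConjecture.Theorems.HCCMUnconditionalHLiu418OfH415
import Summits.HodgeConjecture.HodgeConjecture.Theorems.HCCMUnconditionalH21
import HarnessLib

/-!
# Crux `HLiu418` (stmt-HodgeConjecture-24832) — `HCCMUnconditional.HLiu418` FROM ONE printed letter, #184♮ `Liu2021.curveTheta_nonOrthogonal₂`,
# and the route item `H413` (stmt-HodgeConjecture-24833); `H21` discharged by ★ `Theorems.H21_proof` (★ CONDITIONAL CLOSER, sorry-free)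

`Summits/HodgeConjecture/HodgeConjecture/Theorems/HCCMUnconditionalHLiu418OfCurveTheta.lean`; namespace
`Summit.HodgeConjecture.HodgeConjecture.Cruxes.HLiu418.HLiu418OfCurveTheta`.

WHAT.  The Theorems-side twin of the registry's certificate (LEAD F0P6-plan «M-152b» (i): `Lines/d6_cm_curve` v2 `HLiu418_of_letter (h184) (h21) (h413)`),
assembled from ★ files only:

* `thmD6_of_curveTheta_nonOrthogonal₂ (h184) : thmD6OneCurveCUF` — [Liu2021, Thm. D.6 (1)] for the one curve from the letter: ★ F3
  `F0AlbCmThetaRowsOfFacts.thmD6_of_facts` fed ★ F1 `F0P6LD1StubS1FactsOfA2P.curveThetaCohFinComponentUnique_hol_of_A₂P h184` (#73 from #184♮) and ★ F2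
  `F0P6LD2StubS1bFactsOfA2P.curveThetaHodgeTypeNecessity_hol_pos_of_curveTheta_nonOrthogonal₂ h184` (#74R from #184♮);
* `s1Shape_of_curveTheta_nonOrthogonal₂ (h184) : S1Shape`, `s1bShape_of_curveTheta_nonOrthogonal₂ (h184) : S1bShape` — the registry's two theta rows
  from the letter (the by-term payments of `stub_S1` ∕ `stub_S1b`);
* `thm415AtFace_of_curveTheta_nonOrthogonal₂ (h184) (h413) : Thm415AtFace` — [Liu2021, Thm. 4.15] at the face, ★ F4 `thm415AtFace_of_thmD6`;
* **`HLiu418_of_curveTheta_nonOrthogonal₂ (h184) (h413) : HCCMUnconditional.HLiu418`** — ★ `HLiu418_of_h415` (III-9′ + `H21` + `H413`, HD3 ∕ (Lp) ∕ III-11 ★ inside)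
  with `H21` := ★ `Theorems.H21_proof` (item stmt-HodgeConjecture-24834 CLOSED); and `HLiu418_of_curveTheta_nonOrthogonal₂_of_items (h184) (h21) (h413)`,
  the same with `h21` a binder (the registry's head shape).

HONEST SCOPE.  CONDITIONAL: the crux decl is NOT closed — it is derived from the ONE printed letter #184♮ ([Liu2021, App. B Thm. B.4 (1) (a)⇒(c);
proof of Prop. D.4 (1) p. 131 L8–21]; deep, no carrier in the tree) and the open route item `H413` ([Liu2021, Prop. 4.13] as printed,
stmt-HodgeConjecture-24833).  Every other input is a kernel-checked ★ theorem.  HC_CM is proved only modulo the 7 printed citations (2 remaining: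
hLiu418 = stmt-HodgeConjecture-24832, h413 = stmt-HodgeConjecture-24833) until rung 0 closes; count-neutral.

## References
* [Liu2021] Y. Liu, *Fourier–Jacobi cycles and arithmetic relative trace formula*, Camb. J. Math. 9 (2021) = arXiv:2102.11518: Thm. 4.18, Thm. 4.15,
  Prop. 4.13; App. B Thm. B.4 (1); App. D Prop. D.4 (1), Rem. D.5, Thm. D.6 (1), Cor. D.9.
* [Shimura1998] G. Shimura, *Abelian varieties with complex multiplication and modular functions* (1998), Thm. 21.4 (`H21`, ★ in-house).
-/

noncomputable section

namespace Summit.HodgeConjecture.HodgeConjecture.Cruxes.HLiu418.HLiu418OfCurveTheta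

set_option linter.dupNamespace false  -- `Summit.HodgeConjecture.HodgeConjecture.…` BY DESIGN (D-0017)

open Summit.HodgeConjecture.CorCM.Lines.A3Liu418
open Summit.HodgeConjecture.CorCM.HypLiu418

/-- **[Liu2021, Thm. D.6 (1)] for the one curve, `thmD6OneCurveCUF`, FROM the letter #184♮** — ★ F3 `thmD6_of_facts` fed the two printed theta letters
#73 ∕ #74R derived from #184♮ by ★ F1 ∕ ★ F2 (the LD1 θ-road and the LD2 organ road in binder form).
[cite: Liu2021, Thm. D.6 (1) p. 132; Prop. D.4 (1) p. 130–131; App. B Thm. B.4 (1) p. 98] -/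
theorem thmD6_of_curveTheta_nonOrthogonal₂ (h184 : Literature.NumberTheory.Automorphic.Liu2021.curveTheta_nonOrthogonal₂) : thmD6OneCurveCUF :=
  F0AlbCmThetaRowsOfFacts.thmD6_of_facts (F0P6LD1StubS1FactsOfA2P.curveThetaCohFinComponentUnique_hol_of_A₂P h184)
    (F0P6LD2StubS1bFactsOfA2P.curveThetaHodgeTypeNecessity_hol_pos_of_curveTheta_nonOrthogonal₂ h184)

/-- **The registry's theta row `S1Shape` ([Liu2021, Prop. D.4 (1)] clause (1)) FROM the letter #184♮** — the by-term payment of `d6_cm_curve.stub_S1`: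
★ F3 `s1Shape_of_facts` ∘ (★ F1, ★ F2). [cite: Liu2021, Prop. D.4 (1) p. 130; App. B Thm. B.4 (1) p. 98] -/
theorem s1Shape_of_curveTheta_nonOrthogonal₂ (h184 : Literature.NumberTheory.Automorphic.Liu2021.curveTheta_nonOrthogonal₂) : S1Shape :=
  F0AlbCmThetaRowsOfFacts.s1Shape_of_facts (F0P6LD1StubS1FactsOfA2P.curveThetaCohFinComponentUnique_hol_of_A₂P h184)
    (F0P6LD2StubS1bFactsOfA2P.curveThetaHodgeTypeNecessity_hol_pos_of_curveTheta_nonOrthogonal₂ h184)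

/-- **The registry's theta row `S1bShape` ([Liu2021, Prop. D.4 (1) clause (2) ∕ Rem. D.5]) FROM the letter #184♮** — the by-term payment of
`d6_cm_curve.stub_S1b`: ★ F3 `s1bShape_of_fact` ∘ ★ F2. [cite: Liu2021, Rem. D.5 p. 131; App. B Thm. B.4 (1) p. 98] -/
theorem s1bShape_of_curveTheta_nonOrthogonal₂ (h184 : Literature.NumberTheory.Automorphic.Liu2021.curveTheta_nonOrthogonal₂) : S1bShape :=
  F0AlbCmThetaRowsOfFacts.s1bShape_of_fact
    (F0P6LD2StubS1bFactsOfA2P.curveThetaHodgeTypeNecessity_hol_pos_of_curveTheta_nonOrthogonal₂ h184)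

/-- **[Liu2021, Thm. 4.15] at the face, `Thm415AtFace`, FROM the letter #184♮ and the route item `H413`** — ★ F4
`A3Liu418Thm415AtFaceOfThmD6.thm415AtFace_of_thmD6` (LA2-p02 (g7): the `a3_liu418` v22 face composition with its one `sorry` `stub_D6` as the
hypothesis — (R0) Frobenius-dense pinning, MULT1 from `H413`, S34 from GS-6 of Thm. D.6 (1), S5) fed `thmD6_of_curveTheta_nonOrthogonal₂ h184`.
[cite: Liu2021, Thm. 4.15; Prop. 4.13; Thm. D.6 (1) p. 132] -/
theorem thm415AtFace_of_curveTheta_nonOrthogonal₂ (h184 : Literature.NumberTheory.Automorphic.Liu2021.curveTheta_nonOrthogonal₂)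
    (h413 : Summit.HodgeConjecture.HodgeConjecture.Theses.HCCMUnconditional.H413) : Thm415AtFace :=
  A3Liu418Thm415AtFaceOfThmD6.thm415AtFace_of_thmD6 (thmD6_of_curveTheta_nonOrthogonal₂ h184) h413

/-- **The crux decl `HCCMUnconditional.HLiu418` ([Liu2021, Thm. 4.18] as printed, transported) FROM the letter #184♮ and the route items `H21`, `H413`**
(the registry's head shape, LEAD «M-152b» (i) `HLiu418_of_letter`, Theorems-homed): ★ `HLiu418_of_h415` ((Lp) ★ `albanese_bettiOne_pullback_bijective_of_isProjectiveOver`,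
III-11 ★ `epsRigidAtFace_holds`, HD3 ★ `Theorems.HD3_proof` inside) at `thm415AtFace_of_curveTheta_nonOrthogonal₂ h184 h413`.
[cite: Liu2021, Thm. 4.18; Thm. 4.15; Lem. 2.4 (1); App. B Thm. B.4 (1) p. 98] -/
theorem HLiu418_of_curveTheta_nonOrthogonal₂_of_items (h184 : Literature.NumberTheory.Automorphic.Liu2021.curveTheta_nonOrthogonal₂)
    (h21 : Summit.HodgeConjecture.HodgeConjecture.Theses.HCCMUnconditional.H21)
    (h413 : Summit.HodgeConjecture.HodgeConjecture.Theses.HCCMUnconditional.H413) :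
    Summit.HodgeConjecture.HodgeConjecture.Theses.HCCMUnconditional.HLiu418 :=
  HLiu418_of_h415 (thm415AtFace_of_curveTheta_nonOrthogonal₂ h184 h413) h21 h413

/-- **★ CONDITIONAL CLOSER of crux `HLiu418` (stmt-HodgeConjecture-24832): `HCCMUnconditional.HLiu418` FROM the ONE printed letter #184♮
`Liu2021.curveTheta_nonOrthogonal₂` ([Liu2021, App. B Thm. B.4 (1) (a)⇒(c); proof of Prop. D.4 (1) p. 131 L8–21]) and the ONE open route item `H413`
([Liu2021, Prop. 4.13] as printed, stmt-HodgeConjecture-24833)** — `H21` ([Shimura1998, Thm. 21.4], stmt-HodgeConjecture-24834) is DISCHARGED by ★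
`Summit.HodgeConjecture.HodgeConjecture.Theorems.H21_proof`.  Every other input of the crux's cone — the LD1 θ-road (F1), the LD2 organ road (F2), the F0
socket's junctions (F3), the `a3_liu418` face composition (F4), the K6 chain behind `stub_D9op`, the GS programme, the floor — is a kernel-checked ★ theorem.
NOT a closure of the item: the letter is printed capital (deep; doubling ∕ Siegel–Weil, no carrier in the tree).
[cite: Liu2021, Thm. 4.18; App. B Thm. B.4 (1) p. 98; App. D proof of Prop. D.4 (1) p. 131 L8–21; Prop. 4.13] [cite: Shimura1998, Thm. 21.4] -/
theorem HLiu418_of_curveTheta_nonOrthogonal₂ (h184 : Literature.NumberTheory.Automorphic.Liu2021.curveTheta_nonOrthogonal₂)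
    (h413 : Summit.HodgeConjecture.HodgeConjecture.Theses.HCCMUnconditional.H413) :
    Summit.HodgeConjecture.HodgeConjecture.Theses.HCCMUnconditional.HLiu418 :=
  HLiu418_of_curveTheta_nonOrthogonal₂_of_items h184 Summit.HodgeConjecture.HodgeConjecture.Theorems.H21_proof h413

end Summit.HodgeConjecture.HodgeConjecture.Cruxes.HLiu418.HLiu418OfCurveTheta

end
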